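import Literature.InformationTheory.Entanglement.TwoRebitSeparabilityProbabilityFibre
import Literature.InformationTheory.Entanglement.TwoRebitSeparabilityProbabilitySlices
import Mathlib.Analysis.SpecialFunctions.PolarCoord
import HarnessLib

/-!
# Two-rebit separability probability on a fibre: rotation of the block and polar coordinates

Third step of the proof of Lovas–Andai 2017, Theorems 1–2 on the fibre over `D = 𝟙`. The slice
volumes `a ↦ λ₄(S(a))`, `a ↦ λ₄(S^Γ(a))` of the previous file depend only on the spectrum of the
symmetric block `X(a) = [[a0, a2], [a2, a1]]`: conjugating `X` by a rotation `R` is undone on the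
slice by `Z ↦ Rᵀ Z R`, a linear map of `ℝ⁴ = ℝ^{2×2}` of determinant `±1`
(`volume_rebitSlice_of_orthogonal`; Lovas–Andai: "the transformation `X ↦ U₂ X U₁` is isometric
with respect to the Hilbert-Schmidt norm"). Writing `X(a) = m·𝟙 + r (cos φ σ₃' + sin φ σ₁)`,
i.e. `a = (m + r cos φ, m − r cos φ, r sin φ)` (Lovas–Andai's parametrisation `R(θ, x, y)` of
`sa(2, ℝ)` with the eigenvalues `x = m + r`, `y = m − r` "directly read out"), the rotation by `φ/2`
diagonalises `X(a)` (`volume_rebitSlice_rot`), and the linear change `(x0, x1) ↦ (m, p)` of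
Jacobian `2` followed by polar coordinates `(p, q) = (r cos φ, r sin φ)` (Mathlib's `polarCoord`,
Jacobian `r`) gives, for every measurable `F : ℝ³ → [0, ∞]` with this rotation invariance,

  `∫⁻ a, F a = 4π · ∫⁻ m, ∫⁻ r > 0, r · F(m + r, m − r, 0)`   (`lintegral_eq_polar_of_rot`),

hence (`volume_rebitFibreBody_one_polar`, `volume_rebitFibrePPTBody_one_polar`)

  `λ₇(D_ℝ(𝟙)) = 4π ∫⁻ m, ∫⁻ r > 0, r · λ₄(S(m + r, m − r, 0))`, and the same for `P_ℝ(𝟙)`, `S^Γ`,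

where the slices over diagonal blocks were computed in the previous file. This is the real case
of the passage "Using the fact that `μ_{d+2}` and `σ(√((I−Y)/(I+Y)))` are invariant under
orthogonal transformation" from Corollary 2 to the double integral of the proof of Theorem 2
(volume form `(x − y) dy dx` of Table 1 = `r dr dφ` up to the constant absorbed in `4π`).

## References

* [LovasAndai2017] A. Lovas, A. Andai, Invariance of separability probability over reduced states
  in 4 × 4 bipartite systems, J. Phys. A 50 (2017) 295303, §2 (parametrisation (R(θ,x,y)),
  Table 1), §3 (proof of Theorem 1; Theorem 2, first display of the proof).
-/

noncomputable section

open MeasureTheory Set Real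
open scoped ENNReal Matrix

namespace Literature.InformationTheory.Entanglement

/-! ### The two-sided multiplication `Z ↦ M Z Nᵀ` on `ℝ⁴` -/

/-- The matrix of `Z ↦ M Z Nᵀ` in the row-major coordinates `matZ` (entry `((i,j),(l,m))` is
`M i l * N j m`; it is `M ⊗ N` re-indexed). Lovas–Andai: the left/right multiplication operators
`L_D`, `R_D` with `det L_D = det R_D = det(D)^n`. [cite: LovasAndai2017, §2 (the operators L_D, R_D)] -/
def rebitConjMatrix (M N : Matrix (Fin 2) (Fin 2) ℝ) : Matrix (Fin 4) (Fin 4) ℝ :=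
  !![M 0 0 * N 0 0, M 0 0 * N 0 1, M 0 1 * N 0 0, M 0 1 * N 0 1;
    M 0 0 * N 1 0, M 0 0 * N 1 1, M 0 1 * N 1 0, M 0 1 * N 1 1;
    M 1 0 * N 0 0, M 1 0 * N 0 1, M 1 1 * N 0 0, M 1 1 * N 0 1;
    M 1 0 * N 1 0, M 1 0 * N 1 1, M 1 1 * N 1 0, M 1 1 * N 1 1]

/-- `rebitConjMatrix M N` acts as `Z ↦ M Z Nᵀ`. [cite: LovasAndai2017, §2 (L_D, R_D)] -/
theorem matZ_rebitConjMatrix_mulVec (M N : Matrix (Fin 2) (Fin 2) ℝ) (k : Fin 4 → ℝ) :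
    matZ (rebitConjMatrix M N *ᵥ k) = M * matZ k * Nᵀ := by
  ext i j
  fin_cases i <;> fin_cases j <;>
    simp [matZ, rebitConjMatrix, Matrix.mulVec, dotProduct, Fin.sum_univ_four, Matrix.mul_apply,
      Fin.sum_univ_two] <;> ring

/-- Multiplicativity (the mixed-product rule for `M ⊗ N`). [folklore] -/
theorem rebitConjMatrix_mul (M M' N N' : Matrix (Fin 2) (Fin 2) ℝ) :
    rebitConjMatrix (M * M') (N * N') = rebitConjMatrix M N * rebitConjMatrix M' N' := by
  ext i j
  fin_cases i <;> fin_cases j <;>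
    simp [rebitConjMatrix, Matrix.mul_apply, Fin.sum_univ_four, Fin.sum_univ_two] <;> ring

/-- `rebitConjMatrix 𝟙 𝟙 = 𝟙`. [folklore] -/
theorem rebitConjMatrix_one : rebitConjMatrix 1 1 = (1 : Matrix (Fin 4) (Fin 4) ℝ) := by
  ext i j
  fin_cases i <;> fin_cases j <;> simp [rebitConjMatrix]

/-- Transposition: `(M ⊗ N)ᵀ = Mᵀ ⊗ Nᵀ`. [folklore] -/
theorem rebitConjMatrix_transpose (M N : Matrix (Fin 2) (Fin 2) ℝ) :
    (rebitConjMatrix M N)ᵀ = rebitConjMatrix Mᵀ Nᵀ := by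
  ext i j
  fin_cases i <;> fin_cases j <;> simp [rebitConjMatrix]

/-- For an orthogonal `R`, `Z ↦ R Z Rᵀ` has determinant `±1` (it is a Hilbert–Schmidt
isometry). [cite: LovasAndai2017, §3 (proof of Theorem 1: "X ↦ U₂XU₁ is isometric")] -/
theorem abs_det_rebitConjMatrix_of_orthogonal {R : Matrix (Fin 2) (Fin 2) ℝ} (hR : Rᵀ * R = 1) :
    |(rebitConjMatrix R R).det| = 1 := by
  set d := (rebitConjMatrix R R).det with hd
  have h1 : (rebitConjMatrix Rᵀ Rᵀ).det = d := by
    rw [← rebitConjMatrix_transpose, Matrix.det_transpose]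
  have h2 : rebitConjMatrix Rᵀ Rᵀ * rebitConjMatrix R R = 1 := by
    rw [← rebitConjMatrix_mul, hR, rebitConjMatrix_one]
  have h3 : d * d = 1 := by
    have h := congrArg Matrix.det h2
    rwa [Matrix.det_mul, h1, Matrix.det_one] at h
  rcases mul_self_eq_one_iff.1 h3 with h | h <;> simp [h]

/-! ### The local congruence in block coordinates; slices over rotated blocks -/

/-- The block part of `Φ_M`: the coordinates of `M X(a) Mᵀ`. [folklore] -/
def rebitSymCongr (M : Matrix (Fin 2) (Fin 2) ℝ) (a : Fin 3 → ℝ) : Fin 3 → ℝ :=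
  ![M 0 0 * M 0 0 * a 0 + 2 * M 0 0 * M 0 1 * a 2 + M 0 1 * M 0 1 * a 1,
    M 1 0 * M 1 0 * a 0 + 2 * M 1 0 * M 1 1 * a 2 + M 1 1 * M 1 1 * a 1,
    M 0 0 * M 1 0 * a 0 + (M 0 0 * M 1 1 + M 0 1 * M 1 0) * a 2 + M 0 1 * M 1 1 * a 1]

/-- `Φ_M (a, k) = (M X(a) Mᵀ, M Z(k) Mᵀ)` in block coordinates. [folklore] -/
theorem rebitFibreCongr_rebitJoin (M : Matrix (Fin 2) (Fin 2) ℝ) (a : Fin 3 → ℝ)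
    (k : Fin 4 → ℝ) :
    rebitFibreCongr M (rebitJoin a k) =
      rebitJoin (rebitSymCongr M a) (rebitConjMatrix M M *ᵥ k) := by
  ext i
  fin_cases i <;>
    simp [rebitJoin, rebitSymCongr, rebitConjMatrix, Matrix.mulVec, dotProduct,
      Fin.sum_univ_four]

/-- An orthogonal matrix is invertible. [folklore] -/
theorem isUnit_of_mul_transpose_eq_one {R : Matrix (Fin 2) (Fin 2) ℝ} (hR : R * Rᵀ = 1) :
    IsUnit R :=
  IsUnit.of_mul_eq_one Rᵀ hR

/-- **Rotating the block transports the slice by `Z ↦ R Z Rᵀ`**: for orthogonal `R`,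
`S(a) = (Z ↦ R Z Rᵀ)⁻¹(S(R X(a) Rᵀ))`. [cite: LovasAndai2017, §3 (proof of Theorem 1)] -/
theorem rebitSlice_eq_preimage_of_orthogonal {R : Matrix (Fin 2) (Fin 2) ℝ} (hR : R * Rᵀ = 1)
    (a : Fin 3 → ℝ) :
    rebitSlice a = Matrix.toLin' (rebitConjMatrix R R) ⁻¹' rebitSlice (rebitSymCongr R a) := by
  ext z
  simp only [rebitSlice, mem_setOf_eq, mem_preimage, Matrix.toLin'_apply]
  rw [← rebitFibreCongr_mem_rebitFibreBody_iff (isUnit_of_mul_transpose_eq_one hR) 1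
    (rebitJoin a z), Matrix.mul_one, hR, rebitFibreCongr_rebitJoin]

/-- The same for the PPT slices. [cite: LovasAndai2017, §3 (proof of Theorem 1)] -/
theorem rebitPPTSlice_eq_preimage_of_orthogonal {R : Matrix (Fin 2) (Fin 2) ℝ}
    (hR : R * Rᵀ = 1) (a : Fin 3 → ℝ) :
    rebitPPTSlice a =
      Matrix.toLin' (rebitConjMatrix R R) ⁻¹' rebitPPTSlice (rebitSymCongr R a) := by
  ext z
  simp only [rebitPPTSlice, mem_setOf_eq, mem_preimage, Matrix.toLin'_apply]
  rw [← rebitFibreCongr_mem_rebitFibrePPTBody_iff (isUnit_of_mul_transpose_eq_one hR) 1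
    (rebitJoin a z), Matrix.mul_one, hR, rebitFibreCongr_rebitJoin]

/-- The determinant of `Z ↦ R Z Rᵀ` is non-zero for orthogonal `R`. [folklore] -/
theorem det_toLin'_rebitConjMatrix_ne_zero {R : Matrix (Fin 2) (Fin 2) ℝ} (hR : R * Rᵀ = 1) :
    LinearMap.det (Matrix.toLin' (rebitConjMatrix R R)) ≠ 0 := by
  rw [LinearMap.det_toLin']
  intro h
  have h1 := abs_det_rebitConjMatrix_of_orthogonal (mul_eq_one_comm.1 hR)
  rw [h, abs_zero] at h1
  exact zero_ne_one h1

/-- **Slice volumes are invariant under rotation of the block**: for orthogonal `R`,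
`λ₄(S(a)) = λ₄(S(R X(a) Rᵀ))`. [cite: LovasAndai2017, §3 (proof of Theorem 1) and Corollary 2 ("invariant under orthogonal transformation")] -/
theorem volume_rebitSlice_of_orthogonal {R : Matrix (Fin 2) (Fin 2) ℝ} (hR : R * Rᵀ = 1)
    (a : Fin 3 → ℝ) :
    volume (rebitSlice a) = volume (rebitSlice (rebitSymCongr R a)) := by
  rw [rebitSlice_eq_preimage_of_orthogonal hR a,
    Measure.addHaar_preimage_linearMap volume (det_toLin'_rebitConjMatrix_ne_zero hR),
    LinearMap.det_toLin', abs_inv,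
    abs_det_rebitConjMatrix_of_orthogonal (mul_eq_one_comm.1 hR), inv_one,
    ENNReal.ofReal_one, one_mul]

/-- The same for the PPT slices. [cite: LovasAndai2017, §3 and Corollary 2] -/
theorem volume_rebitPPTSlice_of_orthogonal {R : Matrix (Fin 2) (Fin 2) ℝ} (hR : R * Rᵀ = 1)
    (a : Fin 3 → ℝ) :
    volume (rebitPPTSlice a) = volume (rebitPPTSlice (rebitSymCongr R a)) := by
  rw [rebitPPTSlice_eq_preimage_of_orthogonal hR a,
    Measure.addHaar_preimage_linearMap volume (det_toLin'_rebitConjMatrix_ne_zero hR),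
    LinearMap.det_toLin', abs_inv,
    abs_det_rebitConjMatrix_of_orthogonal (mul_eq_one_comm.1 hR), inv_one,
    ENNReal.ofReal_one, one_mul]

/-- The rotation by the half angle `φ/2`. [cite: LovasAndai2017, §2 (the rotation O(ϕ))] -/
def rebitHalfRot (φ : ℝ) : Matrix (Fin 2) (Fin 2) ℝ :=
  !![cos (φ / 2), -sin (φ / 2); sin (φ / 2), cos (φ / 2)]

/-- `O(φ/2)` is orthogonal. [folklore] -/
theorem rebitHalfRot_mul_transpose (φ : ℝ) : rebitHalfRot φ * (rebitHalfRot φ)ᵀ = 1 := by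
  have h := sin_sq_add_cos_sq (φ / 2)
  ext i j
  fin_cases i <;> fin_cases j <;> simp [rebitHalfRot, Matrix.mul_apply, Fin.sum_univ_two] <;>
    nlinarith [h]

/-- **Diagonalisation of the block by the half-angle rotation**:
`O(φ/2) diag(m + r, m − r) O(φ/2)ᵀ = [[m + r cos φ, r sin φ], [r sin φ, m − r cos φ]]`
(Lovas–Andai's `R(θ, x, y) = ((x+y)/2) 𝟙 + ((x−y)/2)(cos θ σ₁ + sin θ σ₃)` with `x = m + r`,
`y = m − r`). [cite: LovasAndai2017, §2 (parametrisation R(θ, x, y) of sa(2, ℝ))] -/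
theorem rebitSymCongr_rebitHalfRot (φ m r : ℝ) :
    rebitSymCongr (rebitHalfRot φ) ![m + r, m - r, 0] =
      ![m + r * cos φ, m - r * cos φ, r * sin φ] := by
  have e1 : sin (φ / 2) ^ 2 + cos (φ / 2) ^ 2 = 1 := sin_sq_add_cos_sq (φ / 2)
  have e2 : cos φ = 2 * cos (φ / 2) ^ 2 - 1 := by
    rw [← cos_two_mul, mul_div_cancel₀ φ two_ne_zero]
  have e3 : sin φ = 2 * sin (φ / 2) * cos (φ / 2) := by
    rw [← sin_two_mul, mul_div_cancel₀ φ two_ne_zero]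
  ext i
  fin_cases i <;> simp [rebitSymCongr, rebitHalfRot]
  · linear_combination (m - r) * e1 - r * e2
  · linear_combination (m + r) * e1 + r * e2
  · linear_combination (-r) * e3

/-- **The slice volume depends only on the eigenvalues `m ± r` of the block**:
`λ₄(S(m + r cos φ, m − r cos φ, r sin φ)) = λ₄(S(m + r, m − r, 0))`.
[cite: LovasAndai2017, Corollary 2 and Theorem 2 (reduction to the eigenvalues x, y)] -/
theorem volume_rebitSlice_rot (φ m r : ℝ) :
    volume (rebitSlice ![m + r * cos φ, m - r * cos φ, r * sin φ]) =
      volume (rebitSlice ![m + r, m - r, 0]) := by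
  rw [volume_rebitSlice_of_orthogonal (rebitHalfRot_mul_transpose φ) ![m + r, m - r, 0],
    rebitSymCongr_rebitHalfRot]

/-- The same for the PPT slices. [cite: LovasAndai2017, Corollary 2 and Theorem 2] -/
theorem volume_rebitPPTSlice_rot (φ m r : ℝ) :
    volume (rebitPPTSlice ![m + r * cos φ, m - r * cos φ, r * sin φ]) =
      volume (rebitPPTSlice ![m + r, m - r, 0]) := by
  rw [volume_rebitPPTSlice_of_orthogonal (rebitHalfRot_mul_transpose φ) ![m + r, m - r, 0],
    rebitSymCongr_rebitHalfRot]

/-! ### Measurability of the slice volumes -/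

/-- `a ↦ λ₄(S(a))` is measurable (Fubini). [folklore] -/
theorem measurable_volume_rebitSlice : Measurable fun a => volume (rebitSlice a) := by
  have h : ∀ a, rebitSlice a =
      Prod.mk a ⁻¹' (rebitSplit.symm ⁻¹' rebitFibreBody (1 : Matrix (Fin 2) (Fin 2) ℝ)) := by
    intro a
    ext k
    simp only [rebitSlice, mem_setOf_eq, mem_preimage, rebitSplit_symm_apply]
  simp_rw [h]
  exact measurable_measure_prodMk_left
    ((measurableSet_rebitFibreBody 1).preimage rebitSplit.symm.measurable)

/-- `a ↦ λ₄(S^Γ(a))` is measurable (Fubini). [folklore] -/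
theorem measurable_volume_rebitPPTSlice : Measurable fun a => volume (rebitPPTSlice a) := by
  have h : ∀ a, rebitPPTSlice a =
      Prod.mk a ⁻¹' (rebitSplit.symm ⁻¹' rebitFibrePPTBody (1 : Matrix (Fin 2) (Fin 2) ℝ)) := by
    intro a
    ext k
    simp only [rebitPPTSlice, mem_setOf_eq, mem_preimage, rebitSplit_symm_apply]
  simp_rw [h]
  exact measurable_measure_prodMk_left
    ((measurableSet_rebitFibrePPTBody 1).preimage rebitSplit.symm.measurable)

/-! ### The linear change `(x0, x1, x2) = (m + p, m − p, q)` and polar coordinates in `(p, q)` -/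

/-- The linear change of block coordinates `(m, p, q) ↦ (m + p, m − p, q)` (centre `m = tr X / 2`
and traceless part `(p, q)`), of Jacobian `2`. [cite: LovasAndai2017, §2 (R(θ, x, y)), Table 1] -/
def rebitBlockLin : (Fin 3 → ℝ) →ₗ[ℝ] (Fin 3 → ℝ) :=
  Matrix.toLin' !![1, 1, 0; 1, -1, 0; 0, 0, 1]

/-- Unfolding of `rebitBlockLin`. [folklore] -/
theorem rebitBlockLin_apply (b : Fin 3 → ℝ) :
    rebitBlockLin b = ![b 0 + b 1, b 0 - b 1, b 2] := by
  ext i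
  fin_cases i <;> simp [rebitBlockLin, Matrix.mulVec, dotProduct, Fin.sum_univ_three, sub_eq_add_neg]

/-- `det rebitBlockLin = −2`. [folklore] -/
theorem det_rebitBlockLin : LinearMap.det rebitBlockLin = -2 := by
  rw [rebitBlockLin, LinearMap.det_toLin', Matrix.det_fin_three]
  simp
  norm_num

/-- **Linear change of variables**: `∫⁻ a, F a = 2 ∫⁻ b, F (m + p, m − p, q)` (`b = (m, p, q)`).
[folklore] -/
theorem lintegral_eq_two_mul_lintegral_rebitBlockLin {F : (Fin 3 → ℝ) → ℝ≥0∞}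
    (hF : Measurable F) :
    ∫⁻ a, F a = 2 * ∫⁻ b, F (rebitBlockLin b) := by
  have hdet : LinearMap.det rebitBlockLin ≠ 0 := by rw [det_rebitBlockLin]; norm_num
  have hmeas : Measurable rebitBlockLin :=
    (LinearMap.continuous_of_finiteDimensional rebitBlockLin).measurable
  have h1 : ∫⁻ b, F (rebitBlockLin b) = ENNReal.ofReal (1 / 2) * ∫⁻ a, F a := by
    rw [← lintegral_map hF hmeas, Measure.map_linearMap_addHaar_eq_smul_addHaar volume hdet,
      lintegral_smul_measure, det_rebitBlockLin]
    norm_num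
  rw [h1, ← mul_assoc, show (2 : ℝ≥0∞) = ENNReal.ofReal 2 by norm_num, ← ENNReal.ofReal_mul
    (by norm_num : (0 : ℝ) ≤ 2)]
  norm_num

/-- **Reduction to the eigenvalue half-plane** (`x = m + r`, `y = m − r`, `r > 0`): for a
measurable `F : ℝ³ → [0, ∞]` which is invariant under rotation of the traceless part,
`∫⁻ a, F a = 4π · ∫⁻ m, ∫⁻ r ∈ (0, ∞), r · F(m + r, m − r, 0)` — linear change `(m, p, q)`
(Jacobian `2`), polar coordinates `(p, q) = (r cos φ, r sin φ)` (Jacobian `r`), and the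
`φ`-integral `= 2π`. [cite: LovasAndai2017, Theorem 2 (proof, first display: the (x − y) dy dx form)] -/
theorem lintegral_eq_polar_of_rot {F : (Fin 3 → ℝ) → ℝ≥0∞} (hF : Measurable F)
    (hrot : ∀ φ m r : ℝ, F ![m + r * cos φ, m - r * cos φ, r * sin φ] = F ![m + r, m - r, 0]) :
    ∫⁻ a, F a =
      ENNReal.ofReal (4 * π) * ∫⁻ m : ℝ, ∫⁻ r in Ioi (0 : ℝ), ENNReal.ofReal r * F ![m + r, m - r, 0] := by
  -- Step 1: the linear change.
  rw [lintegral_eq_two_mul_lintegral_rebitBlockLin hF]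
  -- Step 2: split `ℝ³ = ℝ × ℝ²` and use Tonelli.
  set e := MeasurableEquiv.piFinSuccAbove (fun _ : Fin 3 => ℝ) 0 with he
  have hemp : MeasurePreserving e.symm (volume.prod volume) volume :=
    MeasurePreserving.symm _ (volume_preserving_piFinSuccAbove (fun _ : Fin 3 => ℝ) 0)
  have hG : Measurable fun b : Fin 3 → ℝ => F (rebitBlockLin b) :=
    hF.comp (LinearMap.continuous_of_finiteDimensional rebitBlockLin).measurable
  rw [← hemp.lintegral_comp_emb e.symm.measurableEmbedding,
    lintegral_prod (fun z : ℝ × (Fin 2 → ℝ) => F (rebitBlockLin (e.symm z)))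
      (hG.comp e.symm.measurable).aemeasurable]
  -- Step 3: for fixed `m`, the inner integral over `ℝ²` in polar coordinates.
  have hinner : ∀ m : ℝ, ∫⁻ g : Fin 2 → ℝ, F (rebitBlockLin (e.symm (m, g))) =
      ENNReal.ofReal (2 * π) * ∫⁻ r in Ioi (0 : ℝ), ENNReal.ofReal r * F ![m + r, m - r, 0] := by
    intro m
    have hsymm : ∀ p q : ℝ, e.symm (m, ![p, q]) = ![m, p, q] := by
      intro p q
      funext i
      fin_cases i <;> rfl
    have h2 : MeasurePreserving (MeasurableEquiv.finTwoArrow (α := ℝ)).symm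
        (volume.prod volume) volume :=
      MeasurePreserving.symm _ (volume_preserving_finTwoArrow ℝ)
    rw [← h2.lintegral_comp_emb (MeasurableEquiv.finTwoArrow (α := ℝ)).symm.measurableEmbedding,
      ← Measure.volume_eq_prod, ← lintegral_comp_polarCoord_symm]
    have h2arrow : ∀ p q : ℝ, (MeasurableEquiv.finTwoArrow (α := ℝ)).symm (p, q) = ![p, q] := by
      intro p q
      funext i
      fin_cases i <;> rfl
    have hpt : ∀ x : ℝ × ℝ, F (rebitBlockLin (e.symm (m,
        (MeasurableEquiv.finTwoArrow (α := ℝ)).symm (polarCoord.symm x)))) =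
        F ![m + x.1, m - x.1, 0] := by
      intro x
      rw [polarCoord_symm_apply, h2arrow, hsymm, rebitBlockLin_apply]
      simp only [Matrix.cons_val_zero, Matrix.cons_val_one, Matrix.cons_val]
      exact hrot x.2 m x.1
    simp_rw [hpt]
    rw [show polarCoord.target = Ioi (0 : ℝ) ×ˢ Ioo (-π) π from rfl, Measure.volume_eq_prod,
      setLIntegral_prod]
    · have hin : ∀ r : ℝ, ∫⁻ _ in Ioo (-π) π, ENNReal.ofReal r • F ![m + r, m - r, 0] =
          ENNReal.ofReal (2 * π) * (ENNReal.ofReal r * F ![m + r, m - r, 0]) := by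
        intro r
        rw [setLIntegral_const, Real.volume_Ioo, smul_eq_mul, mul_comm]
        congr 2
        ring
      simp_rw [hin]
      rw [lintegral_const_mul' _ _ ENNReal.ofReal_ne_top]
    · refine Measurable.aemeasurable ?_
      refine Measurable.smul (ENNReal.measurable_ofReal.comp measurable_fst) ?_
      refine hF.comp ?_
      refine measurable_pi_iff.2 fun i => ?_
      fin_cases i <;> simp <;> fun_prop
  simp_rw [hinner]
  rw [lintegral_const_mul' _ _ ENNReal.ofReal_ne_top, ← mul_assoc,
    show (2 : ℝ≥0∞) = ENNReal.ofReal 2 by norm_num,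
    ← ENNReal.ofReal_mul (by norm_num : (0 : ℝ) ≤ 2)]
  congr 2
  ring

/-- **The state body over `𝟙` in eigenvalue coordinates**:
`λ₇(D_ℝ(𝟙)) = 4π · ∫⁻ m, ∫⁻ r > 0, r · λ₄(S(m + r, m − r, 0))`.
[cite: LovasAndai2017, Theorem 1 (proof) and Theorem 2 (proof, the denominator integral)] -/
theorem volume_rebitFibreBody_one_polar :
    volume (rebitFibreBody (1 : Matrix (Fin 2) (Fin 2) ℝ)) =
      ENNReal.ofReal (4 * π) *
        ∫⁻ m : ℝ, ∫⁻ r in Ioi (0 : ℝ), ENNReal.ofReal r * volume (rebitSlice ![m + r, m - r, 0]) := by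
  rw [volume_rebitFibreBody_one_eq_lintegral]
  exact lintegral_eq_polar_of_rot measurable_volume_rebitSlice volume_rebitSlice_rot

/-- **The PPT body over `𝟙` in eigenvalue coordinates**:
`λ₇(P_ℝ(𝟙)) = 4π · ∫⁻ m, ∫⁻ r > 0, r · λ₄(S^Γ(m + r, m − r, 0))`.
[cite: LovasAndai2017, Theorem 1 (proof) and Theorem 2 (proof, the numerator integral)] -/
theorem volume_rebitFibrePPTBody_one_polar :
    volume (rebitFibrePPTBody (1 : Matrix (Fin 2) (Fin 2) ℝ)) =
      ENNReal.ofReal (4 * π) *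
        ∫⁻ m : ℝ, ∫⁻ r in Ioi (0 : ℝ),
          ENNReal.ofReal r * volume (rebitPPTSlice ![m + r, m - r, 0]) := by
  rw [volume_rebitFibrePPTBody_one_eq_lintegral]
  exact lintegral_eq_polar_of_rot measurable_volume_rebitPPTSlice volume_rebitPPTSlice_rot

end Literature.InformationTheory.Entanglement

end
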